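import Literature.MathematicalPhysics.QuantumFieldTheory.Balaban1983to89.B9CoReadingCoordsHolder
import Literature.MathematicalPhysics.QuantumFieldTheory.Balaban1983to89.B9RWSums344InputFam

/-!
# `Balaban1983to89.B9CoReadingCoordsInput` — the INPUT NORMS of the κ-fold coordinate model: the (3.44)∕(3.45) input co-readings `InputReadsFam` of
# def-Y's reading `kernelFamilyB` HOLD AT THE COORDINATE PINS, for every bond-sector letter and EVERY configuration `U`

T. Bałaban, *Propagators for lattice gauge theories in a background field*, Commun. Math. Phys. **99** (1985) 389–434
[`Balaban1985BackgroundPropagators`, "B9"]; [4] = T. Bałaban, *Propagators and renormalization transformations for lattice gauge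
theories. II*, Commun. Math. Phys. **96** (1984) 223–250 [`Balaban1984PropagatorsII`].

statement-level skeleton of published theorems with citation tags; proofs where landed; nothing here is a claim about the
Yang–Mills mass gap

THE PRINTED LOCI.  [B9] (3.44)–(3.45) p. 398: *"|(G(U)∇\*_Uλ)(x)|, … ≦ B₀(ε)e^{−δ₀d(y,y′)}(‖λ‖_ε + |λ|)"*, *"‖ζ∇_UG(U)∇\*_Uλ‖_α ≦ B₀(ε,α)(Lʲη)^{−α}(‖ζ‖^ξ_α +
|ζ|)e^{−δ₀d(y,y′)}(‖λ‖_{α+ε} + |λ|)"* for `supp λ ⊂ Δ(y′)`; (3.39)–(3.41) p. 397 (the norms `|λ|`, `‖λ‖_ε` at the scale ξ = L^{−j}); [4] (2.51)–(2.52) p. 232 (block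
majorants), (2.137) p. 247 (the pair parameter t).

WHY THIS FILE (seat n06-d g6; the last displayed CO-READING binders of the N06 certificate after editions 8–10).  n06-k's schema `B9RWSums344InputFam.InputReadsFam K
U bH r blkW blkQ Φ ev A` reads the INPUT side of (3.44)∕(3.45) through a block-norm LETTER `bH ε` (with its own localisation `IsLoc` and size `loc`), the output
side through the family model `A` and probes `Φ β`; the certificate (`…V6EPairMP`, p543491) displays `hIR hIRA hIF : InputReadsFam …` over FREE input-norm letters
`bHX bHXA bHX12`.  THIS FILE constructs the input norm ON THE COORDINATE CARRIER and proves the schema for def-Y's `kernelFamilyB` at the pins: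
* §1 ★ `bHK i bI ε : BlockNorm (toB6 (geo9K i) R H) (XBK κ i → ℝ)`: `loc y F := supK + holK ε` — the class-restricted sup `|F|_{Δ(y)}` and the ξ-Hölder part over
  admissible pairs with base point in the class of `y` of the RESTRICTED values (the jump at the class boundary is counted, exactly as print's `‖λ‖_ε` for `λ ∈
  C^ε₀(Δ̃(y′))`); `IsLoc y F` := `F` vanishes off the class; `cut y` := the class-AVERAGED sharp restriction (`clsCard` = #index bonds of the carrier block, so that
  `Σ_y cut y = id`); `κ = 1` (`loc y (cut y F) = (clsCard y)⁻¹ · loc y F`) — all `BlockNorm` laws proved; NO smooth partition of unity is needed, because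
  `loc_cut_le` compares at the SAME y and `loc y` already reads the restriction.
* §2 ★★ `inputReadsFam_kernelFamilyB_coords` — `InputReadsFam (kernelFamilyB i B cfg O par) U₁ (ε ↦ bHK i bI ε) r (blkBK bI ∘ fst) (blkPK bI ∘ fst) (β ↦ sliceProbe
  (Φ^X_β of holderProbesK)) evBK (familyOp (q ↦ ∇_{q.1} ∘ G ∘ ∇\*_{q.2}))` for EVERY letter, EVERY `U₁`, `r ≥ 2`, `bI` carrier-∕1-faithful: `isLoc` (`off_bound_evBK`),
  `loc_le` (`supK_evDiagK_le`, `holK_evDiagK_le`: ≦ `|J| + ‖J‖_ε` of `geo9K`), `obs4` (the (3.44) sups by `wnorm_le_of_coords`), `obs5` (the (3.45) Hölder quantity by the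
  product rule `holderQB_le_of_probes` of `B9CoReadingCoordsHolder` on the constant family `∇_ν ∘ O ∘ ∇\*_μ`, `pairMemberK_eq`).
* §3 ★ `bond_inputReadsFam_of_pins` — the same under the certificate's pin equations (`𝔭 = holderProbesK`, `bH = bHK`, `blk`, `G`, `Dd ∕ Dds`), radius 2: the binders
  `hIRA` (row 19, G) and `hIF` (rows 20–21, G_D ∕ G₁ ∕ 𝔊) become `have`s once `bHXA ∕ bHX12 := (ε ↦ bHK …)`.
HONEST SCOPE.  Finite-dimensional bookkeeping; the SITE twin (`kernelFamilyS.e4 ∕ .h2`, binder `hIR`) is NOT treated here; nothing of [B9] or [4] asserted (the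
(3.44)∕(3.45) BOUNDS stay the displayed walk-expansion schemas, now ABOUT this concrete input norm); COUNT-NEUTRAL; N06 NOT discharged; one finite 𝕋^{d+1}
programme at fixed ε — nothing continuum, nothing about the mass gap.  Cell `pub-ymgap` (HUMAN RULING D-0062), Track A node N06 [B9], seat `pub-ymgap-dag-n06-d`
(g6), 2026-08-27.
-/

noncomputable section

namespace Literature.MathematicalPhysics.QuantumFieldTheory.Balaban1983to89.B9CoReadingCoordsInput

open B6GlobalChartV1 (PV domT blkV1)
open B6Geom246MultiLevelTorus (geomT triangle_refl_nonneg_T)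
open B6Ineq2142KLevelV1 (β lvl)
open B6KLevelCensusIndexV1 (KIdx Adm adm_symm tpar tpar_nonneg kGeo kGeoG)
open B9GeoNormsKLevelV1 (geo9K geo9K_supNorm_nonneg geo9K_cutH_nonneg)
open B9Thm34Ext (toB6)
open B11SectG (BlockNorm)
open B9CoRealizesRelAtLetters (RelB relB_refl)
open B9CoReadingCoords (evDiagK XBK evBK blkBK)
open Node00 (FBondY IBondY)

variable {d ℓ : ℕ} {hd : 1 ≤ d + 1} {hL : Odd (ℓ + 1) ∧ 1 < ℓ + 1} {b₀ b₁ : ℝ}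
variable {κ : Type} [Fintype κ] [DecidableEq κ]

/-! ## §1 The input block norm of the coordinate carrier: class-restricted sup + ξ-Hölder part, class-averaged sharp cut-offs -/

section InputNorm

variable (i : KIdx d ℓ hd hL b₀ b₁) [Fintype (geo9K i).Site] [DecidableRel (RelB i)] (bI : FBondY i → IBondY i)

/-- the size of the carrier-block class of an index bond (`≥ 1`). [cite: Balaban1984PropagatorsII, (2.45) p.231, bookkeeping] -/
def clsCard (c : IBondY i) : ℕ := (Finset.univ.filter fun y : IBondY i => RelB i c y).card

omit [Fintype κ] [DecidableEq κ] [Fintype (geo9K i).Site] in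
/-- `1 ≤ clsCard`. [cite: Balaban1984PropagatorsII, (2.45) p.231, bookkeeping] -/
theorem one_le_clsCard (c : IBondY i) : 1 ≤ clsCard i c :=
  Finset.card_pos.2 ⟨c, Finset.mem_filter.2 ⟨Finset.mem_univ _, relB_refl i c⟩⟩

omit [Fintype κ] [DecidableEq κ] [Fintype (geo9K i).Site] in
/-- the class size is a class function. [cite: Balaban1984PropagatorsII, (2.45) p.231, bookkeeping] -/
theorem clsCard_eq_of_relB {c y : IBondY i} (h : RelB i c y) : clsCard i c = clsCard i y := by
  unfold clsCard
  congr 1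
  ext y''
  simp only [Finset.mem_filter, Finset.mem_univ, true_and]
  constructor
  · intro h'; exact (h.symm.trans h' : RelB i y y'')
  · intro h'; exact (h.trans h' : RelB i c y'')

omit [Fintype κ] [DecidableEq κ] [Fintype (geo9K i).Site] in
/-- the class-indicator sum under ANY `Fintype` instance of the index bonds is the class size (the block norm below sums with the
geometry's own instance). [cite: Balaban1984PropagatorsII, (2.45) p.231, bookkeeping] -/
theorem sum_ite_relB (inst : Fintype (IBondY i)) (c : IBondY i) (a : ℝ) :
    (∑ y ∈ @Finset.univ (IBondY i) inst, if RelB i c y then a else 0) = (clsCard i c : ℝ) * a := by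
  rw [Finset.sum_ite, Finset.sum_const_zero, add_zero, Finset.sum_const, nsmul_eq_mul]
  congr 2
  unfold clsCard
  congr 1
  ext y
  simp only [Finset.mem_filter, Finset.mem_univ, true_and]

/-- restriction of a coordinate vector to the class of `y` (through the block map `bI` of the first point).
[cite: Balaban1985BackgroundPropagators, (3.44) p.398 («supp λ ⊂ Δ(y′)»), dictionary] -/
def restrK (y : IBondY i) (F : XBK κ i → ℝ) : XBK κ i → ℝ := fun p => if RelB i (bI p.1) y then F p else 0

/-- the class-restricted sup `|F|_{Δ(y)}`. [cite: Balaban1985BackgroundPropagators, (3.39) p.397] -/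
def supK (y : IBondY i) (F : XBK κ i → ℝ) : ℝ := ⨆ p : XBK κ i, |restrK i bI y F p|

/-- the class-restricted ξ-Hölder part at scale `ε`: admissible pairs with base point in the class of `y`, the restricted values (so a jump at
the class boundary is counted, as print's `‖λ‖_ε` for `λ ∈ C^ε₀(Δ̃(y′))`); weight `t^{−ε}` (`B6KLevelCensusIndexV1.tpar`).
[cite: Balaban1985BackgroundPropagators, (3.40)–(3.41) p.397 + (3.44) p.398; Balaban1984PropagatorsII, (2.137) p.247] -/
def holK (ε : ℝ) (y : IBondY i) (F : XBK κ i → ℝ) : ℝ :=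
  ⨆ q : (FBondY i × FBondY i) × Fin (d + 1) × κ × κ,
    if Adm i q.1.1 q.1.2 ∧ RelB i (bI q.1.1) y then
      tpar i q.1.1 q.1.2 ^ (-ε) * |restrK i bI y F (q.1.1, q.2) - restrK i bI y F (q.1.2, q.2)| else 0

omit [Fintype κ] [DecidableEq κ] [Fintype (geo9K i).Site] in
/-- `restrK` is additive. [cite: Balaban1985BackgroundPropagators, (3.39) p.397, bookkeeping] -/
theorem restrK_add (y : IBondY i) (F G : XBK κ i → ℝ) : restrK i bI y (F + G) = restrK i bI y F + restrK i bI y G := by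
  funext p; by_cases h : RelB i (bI p.1) y <;> simp [restrK, h]

omit [Fintype κ] [DecidableEq κ] [Fintype (geo9K i).Site] in
/-- `restrK` commutes with scalars. [cite: Balaban1985BackgroundPropagators, (3.39) p.397, bookkeeping] -/
theorem restrK_smul (y : IBondY i) (r : ℝ) (F : XBK κ i → ℝ) : restrK i bI y (r • F) = r • restrK i bI y F := by
  funext p; by_cases h : RelB i (bI p.1) y <;> simp [restrK, h]

omit [Fintype κ] [DecidableEq κ] [Fintype (geo9K i).Site] in
/-- `restrK` of `−F`. [cite: Balaban1985BackgroundPropagators, (3.39) p.397, bookkeeping] -/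
theorem restrK_neg (y : IBondY i) (F : XBK κ i → ℝ) : restrK i bI y (-F) = -restrK i bI y F := by
  funext p; by_cases h : RelB i (bI p.1) y <;> simp [restrK, h]

omit [Fintype κ] [DecidableEq κ] [Fintype (geo9K i).Site] in
/-- `restrK` is idempotent. [cite: Balaban1985BackgroundPropagators, (3.39) p.397, bookkeeping] -/
theorem restrK_restrK (y : IBondY i) (F : XBK κ i → ℝ) : restrK i bI y (restrK i bI y F) = restrK i bI y F := by
  funext p; by_cases h : RelB i (bI p.1) y <;> simp [restrK, h]

omit [Fintype κ] [DecidableEq κ] [Fintype (geo9K i).Site] in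
/-- `0 ≤ supK`. [cite: Balaban1985BackgroundPropagators, (3.39) p.397, bookkeeping] -/
theorem supK_nonneg (y : IBondY i) (F : XBK κ i → ℝ) : 0 ≤ supK i bI y F := Real.iSup_nonneg fun _ => abs_nonneg _

omit [Fintype κ] [DecidableEq κ] [Fintype (geo9K i).Site] in
/-- each summand of `holK` is `≥ 0`. [cite: Balaban1985BackgroundPropagators, (3.40) p.397, bookkeeping] -/
theorem holK_term_nonneg (ε : ℝ) (y : IBondY i) (F : XBK κ i → ℝ) (q : (FBondY i × FBondY i) × Fin (d + 1) × κ × κ) :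
    0 ≤ (if Adm i q.1.1 q.1.2 ∧ RelB i (bI q.1.1) y then
      tpar i q.1.1 q.1.2 ^ (-ε) * |restrK i bI y F (q.1.1, q.2) - restrK i bI y F (q.1.2, q.2)| else 0) := by
  split_ifs
  · exact mul_nonneg (Real.rpow_nonneg (tpar_nonneg i _ _) _) (abs_nonneg _)
  · exact le_rfl

omit [Fintype κ] [DecidableEq κ] [Fintype (geo9K i).Site] in
/-- `0 ≤ holK`. [cite: Balaban1985BackgroundPropagators, (3.40) p.397, bookkeeping] -/
theorem holK_nonneg (ε : ℝ) (y : IBondY i) (F : XBK κ i → ℝ) : 0 ≤ holK i bI ε y F := Real.iSup_nonneg (holK_term_nonneg i bI ε y F)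

omit [DecidableEq κ] [Fintype (geo9K i).Site] in
/-- `supK (F + G) ≤ supK F + supK G`. [cite: Balaban1985BackgroundPropagators, (3.39) p.397, bookkeeping] -/
theorem supK_add_le (y : IBondY i) (F G : XBK κ i → ℝ) : supK i bI y (F + G) ≤ supK i bI y F + supK i bI y G := by
  refine Real.iSup_le (fun p => ?_) (add_nonneg (supK_nonneg i bI y F) (supK_nonneg i bI y G))
  rw [restrK_add, Pi.add_apply]
  exact (abs_add_le _ _).trans (add_le_add (le_ciSup (f := fun p => |restrK i bI y F p|) (Finite.bddAbove_range _) p)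
    (le_ciSup (f := fun p => |restrK i bI y G p|) (Finite.bddAbove_range _) p))

omit [DecidableEq κ] [Fintype (geo9K i).Site] in
/-- `holK (F + G) ≤ holK F + holK G`. [cite: Balaban1985BackgroundPropagators, (3.40) p.397, bookkeeping] -/
theorem holK_add_le (ε : ℝ) (y : IBondY i) (F G : XBK κ i → ℝ) : holK i bI ε y (F + G) ≤ holK i bI ε y F + holK i bI ε y G := by
  refine Real.iSup_le (fun q => ?_) (add_nonneg (holK_nonneg i bI ε y F) (holK_nonneg i bI ε y G))
  have hF := le_ciSup (f := fun q : (FBondY i × FBondY i) × Fin (d + 1) × κ × κ => (if Adm i q.1.1 q.1.2 ∧ RelB i (bI q.1.1) y then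
      tpar i q.1.1 q.1.2 ^ (-ε) * |restrK i bI y F (q.1.1, q.2) - restrK i bI y F (q.1.2, q.2)| else 0)) (Finite.bddAbove_range _) q
  have hG := le_ciSup (f := fun q : (FBondY i × FBondY i) × Fin (d + 1) × κ × κ => (if Adm i q.1.1 q.1.2 ∧ RelB i (bI q.1.1) y then
      tpar i q.1.1 q.1.2 ^ (-ε) * |restrK i bI y G (q.1.1, q.2) - restrK i bI y G (q.1.2, q.2)| else 0)) (Finite.bddAbove_range _) q
  split_ifs with h
  · rw [if_pos h] at hF hG
    rw [restrK_add, Pi.add_apply, Pi.add_apply]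
    have hw : 0 ≤ tpar i q.1.1 q.1.2 ^ (-ε) := Real.rpow_nonneg (tpar_nonneg i _ _) _
    calc tpar i q.1.1 q.1.2 ^ (-ε) * |restrK i bI y F (q.1.1, q.2) + restrK i bI y G (q.1.1, q.2) -
          (restrK i bI y F (q.1.2, q.2) + restrK i bI y G (q.1.2, q.2))|
        ≤ tpar i q.1.1 q.1.2 ^ (-ε) * (|restrK i bI y F (q.1.1, q.2) - restrK i bI y F (q.1.2, q.2)| +
            |restrK i bI y G (q.1.1, q.2) - restrK i bI y G (q.1.2, q.2)|) := by
          refine mul_le_mul_of_nonneg_left ?_ hw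
          calc _ = |(restrK i bI y F (q.1.1, q.2) - restrK i bI y F (q.1.2, q.2)) +
                (restrK i bI y G (q.1.1, q.2) - restrK i bI y G (q.1.2, q.2))| := by ring_nf
            _ ≤ _ := abs_add_le _ _
      _ ≤ holK i bI ε y F + holK i bI ε y G := by rw [mul_add]; exact add_le_add hF hG
  · exact add_nonneg (holK_nonneg i bI ε y F) (holK_nonneg i bI ε y G)

/-- ★ **THE INPUT BLOCK NORM OF THE COORDINATE CARRIER AT SCALE ε**: `loc y F := |F|_{Δ(y)} + ‖F‖_{ε,Δ(y)}` (class-restricted sup and ξ-Hölder part,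
the restriction's jump at the class boundary counted), `IsLoc y F` := `F` vanishes off the class of `y`, `cut y` := the class-AVERAGED sharp restriction
`(#class)⁻¹ · 1_{class(y)} · F` (so that `Σ_y cut y = id` although classes may carry several index bonds), `κ = 1` (`loc y (cut y F) = (#class)⁻¹·loc y F`).
[cite: Balaban1985BackgroundPropagators, (3.39)–(3.41) p.397 + (3.44) p.398 («‖λ‖_ε + |λ|, supp λ ⊂ Δ(y′)»); Balaban1984PropagatorsII, (2.51)–(2.52) p.232] -/
def bHK {R : ℝ} {H : Prop} (ε : ℝ) : BlockNorm (toB6 (geo9K i) R H) (XBK κ i → ℝ) where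
  loc := fun y F => supK i bI y F + holK i bI ε y F
  cut := fun y =>
    { toFun := fun F p => if RelB i (bI p.1) y then ((clsCard i (bI p.1) : ℝ))⁻¹ * F p else 0
      map_add' := fun F G => by funext p; by_cases h : RelB i (bI p.1) y <;> simp [h, mul_add]
      map_smul' := fun r F => by funext p; by_cases h : RelB i (bI p.1) y <;> simp [h, mul_left_comm] }
  IsLoc := fun y F => ∀ p : XBK κ i, ¬ RelB i (bI p.1) y → F p = 0
  κ := 1
  κ_nonneg := zero_le_one
  loc_nonneg := fun y F => add_nonneg (supK_nonneg i bI y F) (holK_nonneg i bI ε y F)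
  loc_zero := fun y => by
    have h0 : restrK i bI y (0 : XBK κ i → ℝ) = 0 := by funext p; simp [restrK]
    simp only [supK, holK, h0, Pi.zero_apply, abs_zero, sub_zero, mul_zero, ite_self, Real.iSup_const_zero, add_zero]
  loc_add_le := fun y F G => by
    calc supK i bI y (F + G) + holK i bI ε y (F + G) ≤ (supK i bI y F + supK i bI y G) + (holK i bI ε y F + holK i bI ε y G) :=
          add_le_add (supK_add_le i bI y F G) (holK_add_le i bI ε y F G)
      _ = _ := by ring
  loc_neg := fun y F => by
    simp only [supK, holK, restrK_neg, Pi.neg_apply, abs_neg, neg_sub_neg, abs_sub_comm]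
  sum_cut := fun F => by
    funext p
    simp only [Finset.sum_apply, LinearMap.coe_mk, AddHom.coe_mk]
    exact (sum_ite_relB i (toB6 (geo9K i) R H).fin (bI p.1) (((clsCard i (bI p.1) : ℝ))⁻¹ * F p)).trans
      (by rw [← mul_assoc, mul_inv_cancel₀ (by exact_mod_cast (Nat.pos_of_ne_zero (by have := one_le_clsCard i (bI p.1); omega)).ne' : (clsCard i (bI p.1) : ℝ) ≠ 0), one_mul])
  isLoc_cut := fun y F p hp => by simp [hp]
  loc_cut_le := fun y F => by
    rw [one_mul]
    -- on the class of y the cut is the constant multiple (#class y)⁻¹ of F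
    set c : ℝ := ((clsCard i y : ℝ))⁻¹ with hc
    have hc0 : 0 ≤ c := inv_nonneg.2 (Nat.cast_nonneg _)
    have hc1 : c ≤ 1 := inv_le_one_of_one_le₀ (by exact_mod_cast one_le_clsCard i y)
    have hres : restrK i bI y (fun p => if RelB i (bI p.1) y then ((clsCard i (bI p.1) : ℝ))⁻¹ * F p else 0) = c • restrK i bI y F := by
      funext p
      by_cases h : RelB i (bI p.1) y
      · simp only [restrK, if_pos h, Pi.smul_apply, smul_eq_mul, clsCard_eq_of_relB i h, hc]
      · simp only [restrK, if_neg h, Pi.smul_apply, smul_eq_mul, mul_zero]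
    have hsup : supK i bI y (fun p => if RelB i (bI p.1) y then ((clsCard i (bI p.1) : ℝ))⁻¹ * F p else 0) = c * supK i bI y F := by
      simp only [supK, hres, Pi.smul_apply, smul_eq_mul, abs_mul, abs_of_nonneg hc0]
      exact (Real.mul_iSup_of_nonneg hc0 _).symm
    have hhol : holK i bI ε y (fun p => if RelB i (bI p.1) y then ((clsCard i (bI p.1) : ℝ))⁻¹ * F p else 0) = c * holK i bI ε y F := by
      simp only [holK, hres, Pi.smul_apply, smul_eq_mul, ← mul_sub, abs_mul, abs_of_nonneg hc0]
      rw [Real.mul_iSup_of_nonneg hc0]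
      congr 1; funext q
      split_ifs <;> ring
    show supK i bI y (fun p => if RelB i (bI p.1) y then ((clsCard i (bI p.1) : ℝ))⁻¹ * F p else 0) +
        holK i bI ε y (fun p => if RelB i (bI p.1) y then ((clsCard i (bI p.1) : ℝ))⁻¹ * F p else 0) ≤ supK i bI y F + holK i bI ε y F
    rw [hsup, hhol]
    nlinarith [supK_nonneg i bI y F, holK_nonneg i bI ε y F]

end InputNorm

/-! ## §2 ★★ The input co-readings `InputReadsFam` ((3.44)∕(3.45)) of `kernelFamilyB` on the pair-family coordinate model, input norm `bHK` -/

section Input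

open B9RWSums344InputFam (InputReadsFam sliceProbe)
open B9RWSums346SecondDiff (familyOp)
open B9Thm39ReadingCoords (cR39 cR39_nonneg)
open B9CoReadingCoords (assembleK assembleK_smul assembleK_evDiagK coordOpK coordOpK_comp assembleK_coordOpK coordOpK_evDiagK cdBₗ cdsBₗ
  GcoK off_bound_evBK abs_evDiagK_le evDiagK_eq_zero_of)
open B9CoReadingCoordsHolder (PK blkPK probeK wK w₀K holderProbesK holderQB_le_of_probes wnorm_le_of_coords)
open B6KLevelCensusIndexV1 (abs_le_supNormG)
open B9GeoNormsKLevelV1 (geo9K_holder_nonneg)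
open B9GeoLemma21KLevelV1 (one_le_Mh one_le_P)
open Node00 (CfgY BallY liftY supInB holderQB kernelFamilyB BondOpY BondParY cdB cdsB iSup_ball_le)

variable {𝔸 : Type} [NormedRing 𝔸] [NormedAlgebra ℂ 𝔸] [CompleteSpace 𝔸] [FiniteDimensional ℝ 𝔸]
variable (i : KIdx d ℓ hd hL b₀ b₁) [Fintype (geo9K i).Site] [DecidableRel (RelB i)] (b : Module.Basis κ ℝ 𝔸)
variable (B : B9.Backgrounds) (cfg : B.Cfg → CfgY 𝔸 i) (O : BondOpY 𝔸 i) (par : BondParY 𝔸 i) (U₁ : B.Cfg)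
variable {bI : FBondY i → IBondY i}

omit [Fintype (geo9K i).Site] [DecidableRel (RelB i)] [DecidableEq κ] in
/-- the `(ν, μ)`-member of the pair family `∇_{U,ν} ∘ G ∘ ∇\*_{U,μ}` at the pinned single-direction letters IS the scaled coordinate model of
`∇_{U,ν} ∘ O(U) ∘ ∇\*_{U,μ}` (functoriality). [cite: Balaban1985BackgroundPropagators, (3.44)–(3.45) p.398, bookkeeping] -/
theorem pairMemberK_eq (ν μ : Fin (d + 1)) :
    coordOpK b (fun _ : Fin (d + 1) => cdBₗ i (cfg U₁) ν) ∘ₗ (GcoK i b B cfg O U₁ ∘ₗ coordOpK b (fun _ : Fin (d + 1) => cdsBₗ i (cfg U₁) μ)) =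
      cR39 b • coordOpK b (fun _ : Fin (d + 1) => cdBₗ i (cfg U₁) ν ∘ₗ ((O (cfg U₁)).restrictScalars ℝ ∘ₗ cdsBₗ i (cfg U₁) μ)) := by
  rw [GcoK, LinearMap.smul_comp, LinearMap.comp_smul, coordOpK_comp, coordOpK_comp]

omit [CompleteSpace 𝔸] [FiniteDimensional ℝ 𝔸] [NormedAlgebra ℂ 𝔸] [NormedRing 𝔸] [Fintype κ] [Fintype (geo9K i).Site] in
/-- the class-restricted sup of the diagonal evaluation of `J` is `≤ |J|`. [cite: Balaban1985BackgroundPropagators, (3.39) p.397, bookkeeping] -/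
theorem supK_evDiagK_le (y : IBondY i) (J : FBondY i → ℝ) :
    supK i bI y (evDiagK (κ := κ) (D := Fin (d + 1)) J) ≤ (geo9K i).supNorm (Sum.inr J) := by
  refine Real.iSup_le (fun p => ?_) (geo9K_supNorm_nonneg i _)
  unfold restrK
  split_ifs
  · exact (abs_evDiagK_le J p).trans (abs_le_supNormG i J p.1)
  · rw [abs_zero]; exact geo9K_supNorm_nonneg i _

omit [CompleteSpace 𝔸] [FiniteDimensional ℝ 𝔸] [NormedAlgebra ℂ 𝔸] [NormedRing 𝔸] [Fintype κ] [Fintype (geo9K i).Site] in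
/-- the class-restricted ξ-Hölder part of the diagonal evaluation of a `J` supported in the class of `y′` is `≤ ‖J‖_ε` (a partner outside the class has
`J = 0` there, so the restricted difference IS `|J x − J x′|`). [cite: Balaban1985BackgroundPropagators, (3.40)–(3.41) p.397 + (3.44) p.398; Balaban1984PropagatorsII, (2.137) p.247] -/
theorem holK_evDiagK_le
    (hβI : ∀ (x : FBondY i) (c : IBondY i), blkV1 i.hN i.D x = β i.hN i.D i.hk c → β i.hN i.D i.hk (bI x) = blkV1 i.hN i.D x)
    (ε : ℝ) (y' : IBondY i) (J : FBondY i → ℝ) (hs : (geo9K i).suppIn (Sum.inr J) y') :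
    holK i bI ε y' (evDiagK (κ := κ) (D := Fin (d + 1)) J) ≤ (geo9K i).holder ε (Sum.inr J) := by
  have hJ0 : ∀ x', ¬ RelB i (bI x') y' → J x' = 0 := by
    intro x' hx'
    by_contra hJ
    exact hx' ((hβI x' y' (hs x' hJ)).trans (hs x' hJ))
  refine Real.iSup_le (fun q => ?_) (geo9K_holder_nonneg i ε _)
  split_ifs with h
  · obtain ⟨hadm, hrel⟩ := h
    have hterm : tpar i q.1.1 q.1.2 ^ (-ε) * |J q.1.1 - J q.1.2| ≤ (geo9K i).holder ε (Sum.inr J) := by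
      have := le_ciSup (f := fun qq : FBondY i × FBondY i => if Adm i qq.1 qq.2 then tpar i qq.1 qq.2 ^ (-ε) * |J qq.1 - J qq.2| else 0)
        (Finite.bddAbove_range _) (q.1.1, q.1.2)
      simp only [if_pos hadm] at this
      exact this
    refine le_trans (mul_le_mul_of_nonneg_left ?_ (Real.rpow_nonneg (tpar_nonneg i _ _) _)) hterm
    -- the restricted difference of the diagonal evaluation is `≤ |J x − J x′|`
    simp only [restrK, if_pos hrel, evDiagK]
    by_cases hc : q.2.2.1 = q.2.2.2
    · simp only [hc, if_true]
      by_cases hr : RelB i (bI q.1.2) y'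
      · rw [if_pos hr]
      · rw [if_neg hr, hJ0 q.1.2 hr]
    · simp only [hc, if_false, ite_self, sub_zero, abs_zero]; exact abs_nonneg _
  · exact geo9K_holder_nonneg i ε _

/-- ★★ **THE INPUT CO-READINGS (3.44)∕(3.45) OF `kernelFamilyB` HOLD ON THE PAIR-FAMILY COORDINATE MODEL WITH THE INPUT NORM `bHK`** — for EVERY bond-sector
letter `O`, EVERY `U₁`, every real basis `b`, every radius `r ≥ 2`, given `bI` carrier-faithful (`hβI`) and 1-faithful (`hβ1`): n06-k's schema
`InputReadsFam K U (bH) r blkW blkQ Φ ev A` at `bH := bHK i bI`, the pair family `A := familyOp (q ↦ Dd q.1 ∘ G ∘ Dds q.2)` over the scaled coordinate model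
`G = GcoK …` and the pinned single-direction letters `Dd ∕ Dds`, the probes `Φ β := sliceProbe (Φ^X_β)` of the Hölder probes `holderProbesK`: `isLoc` ∕ `loc_le` by
`off_bound_evBK`, `supK_evDiagK_le`, `holK_evDiagK_le`; `obs4` (e4 = sup_E sup_{ν,μ} sup_{x∈Δ(y)} ‖∇_ν O ∇\*_μ (J⊗E)(x)‖) by the coordinate domination
`wnorm_le_of_coords`; `obs5` (h2 = sup_E sup_{ν,μ} holderQB …) by the product rule `holderQB_le_of_probes` on the constant family `∇_ν ∘ O ∘ ∇\*_μ`.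
[cite: Balaban1985BackgroundPropagators, (3.44)–(3.45) p.398 + (3.39)–(3.41) p.397; Balaban1984PropagatorsII, (2.51)–(2.52) p.232 + (2.54) p.233 + (2.137) p.247] -/
theorem inputReadsFam_kernelFamilyB_coords
    (hβI : ∀ (x : FBondY i) (c : IBondY i), blkV1 i.hN i.D x = β i.hN i.D i.hk c → β i.hN i.D i.hk (bI x) = blkV1 i.hN i.D x)
    (hβ1 : ∀ x : FBondY i, (geomT i.D).dist (β i.hN i.D i.hk (bI x)) (blkV1 i.hN i.D x) ≤ 1) {r : ℝ} (hr : 2 ≤ r) {R : ℝ} {H : Prop}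
    {Dd Dds : Fin (d + 1) → ((XBK κ i → ℝ) →ₗ[ℝ] (XBK κ i → ℝ))}
    (hDd : Dd = fun μ => coordOpK b (fun _ : Fin (d + 1) => cdBₗ i (cfg U₁) μ))
    (hDds : Dds = fun μ => coordOpK b (fun _ : Fin (d + 1) => cdsBₗ i (cfg U₁) μ)) :
    InputReadsFam (R := R) (H := H) (kernelFamilyB i B cfg O par) U₁ (fun ε => bHK i bI ε) r (blkBK i bI ∘ Prod.fst)
      (blkPK bI ∘ Prod.fst) (fun β => sliceProbe ((holderProbesK i b B cfg par bI).ΦX U₁ β)) (evBK i)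
      (familyOp fun q : Fin (d + 1) × Fin (d + 1) => Dd q.1 ∘ₗ (GcoK i b B cfg O U₁ ∘ₗ Dds q.2)) := by
  subst hDd hDds
  -- the (ν, μ)-member as a scaled coordinate model of a CONSTANT family
  set T : Fin (d + 1) → Fin (d + 1) → (FBondY i → 𝔸) →ₗ[ℝ] (FBondY i → 𝔸) :=
    fun ν μ => cdBₗ i (cfg U₁) ν ∘ₗ ((O (cfg U₁)).restrictScalars ℝ ∘ₗ cdsBₗ i (cfg U₁) μ) with hT
  have hmem : ∀ (ν μ : Fin (d + 1)) (F : XBK κ i → ℝ) (v : XBK κ i),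
      (familyOp (fun q : Fin (d + 1) × Fin (d + 1) =>
        coordOpK b (fun _ : Fin (d + 1) => cdBₗ i (cfg U₁) q.1) ∘ₗ (GcoK i b B cfg O U₁ ∘ₗ coordOpK b (fun _ : Fin (d + 1) => cdsBₗ i (cfg U₁) q.2))) F)
          (v, (ν, μ)) = (cR39 b • coordOpK b (fun _ : Fin (d + 1) => T ν μ)) F v := by
    intro ν μ F v
    show (coordOpK b (fun _ : Fin (d + 1) => cdBₗ i (cfg U₁) ν) ∘ₗ (GcoK i b B cfg O U₁ ∘ₗ coordOpK b (fun _ : Fin (d + 1) => cdsBₗ i (cfg U₁) μ))) F v = _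
    rw [pairMemberK_eq]
  have hE' : ∀ E : BallY 𝔸, ‖(E : 𝔸)‖ ≤ 1 := fun E => mem_closedBall_zero_iff.1 E.2
  refine ⟨?_, ?_, ?_, ?_, ?_, ?_⟩
  · -- isLoc
    intro ε lam y' hs
    exact (off_bound_evBK (κ := κ) i hβI).1 lam y' hs
  · -- loc_le
    intro ε lam y' hs
    show supK i bI y' (evBK i lam) + holK i bI ε y' (evBK i lam) ≤ (geo9K i).holder ε lam + (geo9K i).supNorm lam
    cases lam with
    | inl f =>
        have h0 : evBK (κ := κ) i (Sum.inl f) = 0 := rfl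
        have hl : supK i bI y' (evBK (κ := κ) i (Sum.inl f)) + holK i bI ε y' (evBK (κ := κ) i (Sum.inl f)) = 0 := by
          rw [h0]; exact (bHK (R := R) (H := H) i bI ε).loc_zero y'
        rw [hl]; exact add_nonneg (geo9K_holder_nonneg i ε _) (geo9K_supNorm_nonneg i _)
    | inr J =>
        rw [add_comm]
        exact add_le_add (holK_evDiagK_le i hβI ε y' J hs) (supK_evDiagK_le i y' J)
  · -- hs_nonneg
    intro ε lam
    exact add_nonneg (geo9K_holder_nonneg i ε lam) (geo9K_supNorm_nonneg i lam)
  · -- cutH_nonneg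
    intro β' ζ
    exact geo9K_cutH_nonneg i β' ζ
  · -- obs4: the (3.44) sup entries through the family model at anchors within 1 of y
    intro lam y c hc hw
    cases lam with
    | inl f => exact hc
    | inr J =>
        show (⨆ E : BallY 𝔸, ⨆ ν : Fin (d + 1), ⨆ μ : Fin (d + 1),
            supInB i (β i.hN i.D i.hk y) (cdB i (cfg U₁) ν (O (cfg U₁) (cdsB i (cfg U₁) μ (liftY J (E : 𝔸)))))) ≤ c
        refine iSup_ball_le (fun E => Real.iSup_le (fun ν => Real.iSup_le (fun μ => ?_) hc) hc) hc
        unfold supInB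
        refine Real.iSup_le (fun x => ?_) hc
        have hnear : (geomT i.D).dist (β i.hN i.D i.hk (bI x.1)) (β i.hN i.D i.hk y) ≤ r := by
          have h1 := hβ1 x.1
          rw [x.2] at h1
          linarith
        have key := wnorm_le_of_coords b (T ν μ) J x.1 zero_le_one hc (fun cc cc' => ?_) (hE' E)
        · rw [one_mul] at key
          exact key
        have h2 := hw ((x.1, ν, cc, cc'), (ν, μ)) hnear
        have hev : evBK (κ := κ) i (Sum.inr J) = evDiagK J := rfl
        rw [hmem, hev] at h2
        simp only [LinearMap.smul_apply, Pi.smul_apply, coordOpK_evDiagK, smul_eq_mul] at h2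
        rw [one_mul]; exact h2
  · -- obs5: the (3.45) Hölder quantity through the sliced probes
    intro lam β' ζ y c hc hcut hP
    have h0 : 0 ≤ c * (geo9K i).cutH β' ζ := mul_nonneg hc (geo9K_cutH_nonneg i β' ζ)
    cases lam with
    | inl f => cases ζ with
      | inl zz => exact h0
      | inr zz => exact h0
    | inr J => cases ζ with
      | inl zz => exact h0
      | inr zz =>
          show (⨆ E : BallY 𝔸, ⨆ ν : Fin (d + 1), ⨆ μ : Fin (d + 1),
              holderQB i (par (cfg U₁)) β' zz (cdB i (cfg U₁) ν (O (cfg U₁) (cdsB i (cfg U₁) μ (liftY J (E : 𝔸)))))) ≤ c * (kGeo i).cutH β' zz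
          refine iSup_ball_le (fun E => Real.iSup_le (fun ν => Real.iSup_le (fun μ => ?_) h0) h0) h0
          exact holderQB_le_of_probes i b hβ1 hr (par (cfg U₁)) (fun _ : Fin (d + 1) => T ν μ) J β' zz y hc
            hcut (fun p hp => by
              have h2 := hP (p, (ν, μ)) hp
              have hsl : (fun v => (familyOp (fun q : Fin (d + 1) × Fin (d + 1) =>
                  coordOpK b (fun _ : Fin (d + 1) => cdBₗ i (cfg U₁) q.1) ∘ₗ (GcoK i b B cfg O U₁ ∘ₗ
                    coordOpK b (fun _ : Fin (d + 1) => cdsBₗ i (cfg U₁) q.2))) (evBK i (Sum.inr J))) (v, (ν, μ))) =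
                  (cR39 b • coordOpK b (fun _ : Fin (d + 1) => T ν μ)) (evDiagK J) := by
                funext v; rw [hmem]; rfl
              rw [← hsl]
              exact h2) E ν

/-- ★ **THE INPUT CO-READINGS UNDER THE CERTIFICATE'S PINS, RADIUS 2**: probes `𝔭 = holderProbesK …`, input norm `bH = bHK …`, block map `blk = blkBK bI`,
`G = GcoK …` and the single-direction letters `Dd ∕ Dds` pinned to the coordinate letters ⇒ `InputReadsFam (kernelFamilyB …) U₁ bH 2 (blk ∘ fst) (𝔭.blkPX ∘ fst)
(β ↦ sliceProbe (𝔭.ΦX U₁ β)) evBK (familyOp (q ↦ Dd q.1 ∘ G ∘ Dds q.2))` — the shape of the certificate's binders `hIRA` (row 19) and `hIF` (rows 20–21).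
[cite: Balaban1985BackgroundPropagators, (3.44)–(3.45) p.398; Balaban1984PropagatorsII, (2.51)–(2.52) p.232] -/
theorem bond_inputReadsFam_of_pins
    (hβI : ∀ (x : FBondY i) (c : IBondY i), blkV1 i.hN i.D x = β i.hN i.D i.hk c → β i.hN i.D i.hk (bI x) = blkV1 i.hN i.D x)
    (hβ1 : ∀ x : FBondY i, (geomT i.D).dist (β i.hN i.D i.hk (bI x)) (blkV1 i.hN i.D x) ≤ 1) {R : ℝ} {H : Prop}
    {𝔭 : B9RWSums343Holder.HolderProbes (geo9K i) B (XBK κ i) (XBK κ i) (PK (FBondY i) (Fin (d + 1)) κ) (PK (FBondY i) (Fin (d + 1)) κ)}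
    {bH : ℝ → BlockNorm (toB6 (geo9K i) R H) (XBK κ i → ℝ)} {blk : XBK κ i → IBondY i} {G : (XBK κ i → ℝ) →ₗ[ℝ] (XBK κ i → ℝ)}
    {Dd Dds : Fin (d + 1) → ((XBK κ i → ℝ) →ₗ[ℝ] (XBK κ i → ℝ))}
    (h𝔭 : 𝔭 = holderProbesK i b B cfg par bI) (hbH : bH = fun ε => bHK i bI ε) (hblk : blk = blkBK i bI) (hG : G = GcoK i b B cfg O U₁)
    (hDd : Dd = fun μ => coordOpK b (fun _ : Fin (d + 1) => cdBₗ i (cfg U₁) μ))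
    (hDds : Dds = fun μ => coordOpK b (fun _ : Fin (d + 1) => cdsBₗ i (cfg U₁) μ)) :
    InputReadsFam (R := R) (H := H) (kernelFamilyB i B cfg O par) U₁ bH 2 (blk ∘ Prod.fst) (𝔭.blkPX ∘ Prod.fst) (fun β => sliceProbe (𝔭.ΦX U₁ β)) (evBK i)
      (familyOp fun q : Fin (d + 1) × Fin (d + 1) => Dd q.1 ∘ₗ (G ∘ₗ Dds q.2)) := by
  subst h𝔭 hbH hblk hG
  exact inputReadsFam_kernelFamilyB_coords i b B cfg O par U₁ hβI hβ1 le_rfl hDd hDds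

end Input

end Literature.MathematicalPhysics.QuantumFieldTheory.Balaban1983to89.B9CoReadingCoordsInput

end
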